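import Literature.Probability.RandomPlanarGeometry.SAWUnfolding
import Literature.Probability.RandomPlanarGeometry.SAWBridgeRenewalEquation
import HarnessLib

/-!
# Max-height-monotone unfolding: walks reaching height `H` versus bridges of height `≥ H` (DCH 2013 §2.4; lane «DCH-1.1» K4b)

Topic `Literature/Probability/RandomPlanarGeometry` (continues `SAWUnfolding.lean` — the Hammersley–Welsh unfolding
`Zd.unfold`, its code `Zd.code`, `Zd.unfold_code_injOn`, `Zd.code_mem_finsetsOfSumLE` — and `SAWBridges.lean` /
`SAWBridgeRenewalEquation.lean` — the split `Zd.headWalk`/`Zd.tailWalk` at the last minimum and the gluing `Zd.concatWalk`).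

Source: H. Duminil-Copin, A. Hammond, *Self-avoiding walk is sub-ballistic*, Commun. Math. Phys. 324 (2013), §2.4
(arXiv:1205.0401, p. 7): "we use the classical unfolding operation from walks into bridges … noting that
`max{y(γ_k)}` increases at each step, and that the outcome, being an element of SAB, has the property that this maximum
is attained by `k = n`"; N. Madras, G. Slade, *The Self-Avoiding Walk* (1993), §3.1 (Theorem 3.1.1 – Corollary 3.1.6:
split at the last lowest point, unfold the two half-space pieces, concatenate; multiplicity `e^{O(√N)}`).

## What is proved (every dimension `d ≥ 1`; the lane's typed node `MaxHeightUnfolding`, a-idea-2 `Sketch_v8_DCH11.lean`)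
* `maxLevel_le_unfold_last` — the unfolding never lowers the maximal height, and the unfolded walk attains it at the end;
* `concat_unfold_height_ge` — for the walks→bridges map `Φ(ω) = unfold(head ω) ⊕ unfold(tail ω)` (an `(n+1)`-step
  bridge), `max_k y(ω_k) ≤ y(Φ(ω)_{n+1})`;
* **`card_reachHeight_le_exp_mul_card_bridges`**: for all `n`, `H`,
  `#{ω ∈ S_n : ∃ k ≤ n, H ≤ y(ω_k)} ≤ e^{8√(n+1)} · #{β ∈ B_{n+1} : H ≤ y(β_{n+1})}` (the map `Φ` together with the cut
  time and the two codes is injective; `(n+1)·#codes² ≤ e^{8√(n+1)}`);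
* **`maxHeightUnfolding`** — the node as typed (`∀ d ≥ 2, ∃ C, ∀ n H, … ≤ e^{C√(n+1)} · …`, with `C = 8`).
Tree-twin search: stems `MaxHeight`, `reachHeight`, `unfold_last` → only `apply_le_unfold_last` (used). No twin.
-/

noncomputable section

open Finset Literature.Probability.LatticeModels Literature.Probability.Percolation
open Literature.Combinatorics.Enumerative

namespace Literature.Probability.RandomPlanarGeometry.SAW.Zd

variable {d : ℕ} [NeZero d]

/-! ### The unfolding raises the maximum height to the endpoint -/

/-- Along the iterated unfolding the maximal first coordinate never decreases. [cite: MadrasSlade1993, §3.1, proof of Proposition 3.1.5] -/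
theorem maxLevel_le_maxLevel_iterate (n : ℕ) (ω : ℕ → Site d) (k : ℕ) :
    maxLevel n ω ≤ maxLevel n ((unfoldStep n)^[k] ω) := by
  induction k with
  | zero => exact le_rfl
  | succ k ih =>
    rw [Function.iterate_succ_apply']
    exact ih.trans (maxLevel_le_maxLevel_unfoldStep n _)

/-- **The unfolded walk ends at least as high as the original walk ever was**: `y(ω_i) ≤ y(unfold(ω)_n)` for
`i ≤ n`. [cite: DuminilCopinHammond2013, §2.4 ("max{y(γ_k)} increases at each step … attained by k = n")] -/
theorem apply_le_unfold_last_of_le {n : ℕ} {ω : ℕ → Site d} (hω : ω ∈ saws d n) {i : ℕ} (hi : i ≤ n) :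
    ω i 0 ≤ unfold n ω n 0 := by
  have h1 : ω i 0 ≤ maxLevel n (unfold n ω) := (apply_le_maxLevel ω hi).trans (maxLevel_le_maxLevel_iterate n ω (n + 1))
  refine h1.trans (maxLevel_le fun j hj => apply_le_unfold_last hω hj)

/-- The endpoint of a bridge is at non-negative height. [cite: MadrasSlade1993, Definition 1.2.4] -/
theorem bridge_last_nonneg {L : ℕ} {β : ℕ → Site d} (hβ : β ∈ bridges d L) : 0 ≤ β L 0 := by
  obtain ⟨hs, hbr⟩ := mem_bridges.1 hβ
  have h0 : β 0 = 0 := (mem_saws.1 hs).1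
  rcases Nat.eq_zero_or_pos L with rfl | hL
  · rw [h0]; exact le_rfl
  · have := (hbr L hL le_rfl).1; rw [h0] at this; exact le_of_lt this

/-! ### The walks → bridges map and its height -/

/-- The unfolded head piece: an `(m+1)`-step bridge (`m` = last minimum). [cite: MadrasSlade1993, §3.1, eq. (3.1.7)] -/
theorem unfold_headWalk_mem {n : ℕ} {ω : ℕ → Site d} (hω : ω ∈ saws d n) :
    unfold (lastMin n ω + 1) (headWalk n ω) ∈ bridges d (lastMin n ω + 1) :=
  unfold_mem_bridges (headWalk_mem hω)

/-- The unfolded tail piece: an `(n-m)`-step bridge. [cite: MadrasSlade1993, §3.1, eq. (3.1.7)] -/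
theorem unfold_tailWalk_mem {n : ℕ} {ω : ℕ → Site d} (hω : ω ∈ saws d n) :
    unfold (n - lastMin n ω) (tailWalk n ω) ∈ bridges d (n - lastMin n ω) :=
  unfold_mem_bridges (tailWalk_mem hω)

/-- The glued bridge `Φ(ω) = unfold(head ω) ⊕ unfold(tail ω)` is an `(n+1)`-step bridge.
[cite: MadrasSlade1993, §3.1, eq. (3.1.7)] -/
theorem concat_unfold_mem {n : ℕ} {ω : ℕ → Site d} (hω : ω ∈ saws d n) :
    concatWalk (lastMin n ω + 1) (unfold (lastMin n ω + 1) (headWalk n ω)) (unfold (n - lastMin n ω) (tailWalk n ω)) ∈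
      bridges d (n + 1) := by
  have hmn := lastMin_le n ω
  refine concatWalk_mem_bridges (by omega) (unfold_headWalk_mem hω) ?_
  rw [show n + 1 - (lastMin n ω + 1) = n - lastMin n ω by omega]
  exact unfold_tailWalk_mem hω

/-- **Height bookkeeping**: the endpoint height of `Φ(ω)` is the sum of the two spans and dominates
`max_k y(ω_k)`. [cite: DuminilCopinHammond2013, §2.4] -/
theorem concat_unfold_height_ge {n : ℕ} {ω : ℕ → Site d} (hω : ω ∈ saws d n) {k : ℕ} (hk : k ≤ n) :
    ω k 0 ≤ concatWalk (lastMin n ω + 1) (unfold (lastMin n ω + 1) (headWalk n ω))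
      (unfold (n - lastMin n ω) (tailWalk n ω)) (n + 1) 0 := by
  set m := lastMin n ω with hm
  have hmn : m ≤ n := lastMin_le n ω
  have hH := (mem_halfSpaceWalks.1 (headWalk_mem hω)).1
  have hT := (mem_halfSpaceWalks.1 (tailWalk_mem hω)).1
  have hT0 : unfold (n - m) (tailWalk n ω) 0 = 0 := (mem_saws.1 (unfold_mem_saws hT)).1
  have hend : concatWalk (m + 1) (unfold (m + 1) (headWalk n ω)) (unfold (n - m) (tailWalk n ω)) (n + 1) 0 =
      unfold (m + 1) (headWalk n ω) (m + 1) 0 + unfold (n - m) (tailWalk n ω) (n - m) 0 := by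
    rw [show n + 1 = (m + 1) + (n - m) by omega, concatWalk_apply_add _ _ hT0, Pi.add_apply]
  rw [hend]
  have hm0 : ω m 0 ≤ 0 := by
    have := apply_lastMin_le (ω := ω) (n := n) (i := 0) (Nat.zero_le n)
    rw [← hm, (mem_saws.1 hω).1] at this
    simpa using this
  have hA : 0 ≤ unfold (m + 1) (headWalk n ω) (m + 1) 0 := bridge_last_nonneg (unfold_headWalk_mem hω)
  have hB : 0 ≤ unfold (n - m) (tailWalk n ω) (n - m) 0 := bridge_last_nonneg (unfold_tailWalk_mem hω)
  rcases le_or_gt k m with hkm | hkm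
  · -- `ω k` is a point of the head piece (index `m + 1 - k ≥ 1`)
    have hpt : headWalk n ω (m + 1 - k) 0 = ω k 0 - ω m 0 + 1 := by
      rw [headWalk_apply hm.symm, if_neg (by omega), min_eq_left (by omega : m + 1 - k ≤ m + 1),
        show m + 1 - (m + 1 - k) = k by omega]
      simp
    have h1 : headWalk n ω (m + 1 - k) 0 ≤ unfold (m + 1) (headWalk n ω) (m + 1) 0 :=
      apply_le_unfold_last_of_le hH (by omega)
    linarith
  · -- `ω k` is a point of the tail piece (index `k - m`)
    have hpt : tailWalk n ω (k - m) 0 = ω k 0 - ω m 0 := by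
      rw [tailWalk_apply hm.symm, min_eq_left (by omega : k - m ≤ n - m), show m + (k - m) = k by omega]
      simp
    have h1 : tailWalk n ω (k - m) 0 ≤ unfold (n - m) (tailWalk n ω) (n - m) 0 :=
      apply_le_unfold_last_of_le hT (by omega)
    linarith

/-! ### Counting: the map with its cut time and codes is injective -/

/-- Codes of shorter walks are codes for the longer length. [folklore] -/
private theorem finsetsOfSumLE_mono {a b : ℕ} (h : a ≤ b) : finsetsOfSumLE a ⊆ finsetsOfSumLE b := by
  intro S hS
  rw [mem_finsetsOfSumLE] at hS ⊢
  exact ⟨hS.1, hS.2.trans h⟩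

open Classical in
/-- **The counting inequality**: `#{ω ∈ S_n : ∃ k ≤ n, H ≤ y(ω_k)} ≤ (n+1) · #codes(n+1)² · #{β ∈ B_{n+1} : H ≤ y(β_{n+1})}`.
[cite: DuminilCopinHammond2013, §2.4; MadrasSlade1993, §3.1, eq. (3.1.7)] -/
theorem card_reachHeight_le (n : ℕ) (H : ℤ) :
    ((saws d n).filter fun ω => ∃ k ≤ n, H ≤ ω k 0).card ≤
      (n + 1) * (finsetsOfSumLE (n + 1)).card ^ 2 *
        ((bridges d (n + 1)).filter fun β => H ≤ β (n + 1) 0).card := by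
  set T := (saws d n).filter fun ω => ∃ k ≤ n, H ≤ ω k 0 with hT
  set B := (bridges d (n + 1)).filter fun β => H ≤ β (n + 1) 0 with hB
  set F := finsetsOfSumLE (n + 1) with hF
  set Θ : (ℕ → Site d) → ℕ × (ℕ → Site d) × Finset ℕ × Finset ℕ := fun ω =>
    (lastMin n ω,
      concatWalk (lastMin n ω + 1) (unfold (lastMin n ω + 1) (headWalk n ω)) (unfold (n - lastMin n ω) (tailWalk n ω)),
      code (lastMin n ω + 1) (headWalk n ω), code (n - lastMin n ω) (tailWalk n ω)) with hΘ
  have hcard : (Finset.range (n + 1) ×ˢ (B ×ˢ (F ×ˢ F))).card = (n + 1) * F.card ^ 2 * B.card := by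
    rw [Finset.card_product, Finset.card_product, Finset.card_product, Finset.card_range]; ring
  rw [← hcard]
  refine Finset.card_le_card_of_injOn Θ (fun ω hω => ?_) (fun ω hω ω' hω' h => ?_)
  · -- `Θ` maps into the product
    rw [Finset.mem_coe, hT, Finset.mem_filter] at hω
    obtain ⟨hωs, k, hk, hHk⟩ := hω
    have hmn := lastMin_le n ω
    have hH := (mem_halfSpaceWalks.1 (headWalk_mem hωs)).1
    have hTl := (mem_halfSpaceWalks.1 (tailWalk_mem hωs)).1
    simp only [hΘ, Finset.mem_coe, Finset.mem_product, Finset.mem_range]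
    refine ⟨Nat.lt_succ_of_le hmn, ?_, ?_, ?_⟩
    · rw [hB, Finset.mem_filter]
      exact ⟨concat_unfold_mem hωs, hHk.trans (concat_unfold_height_ge hωs hk)⟩
    · exact finsetsOfSumLE_mono (by omega) (code_mem_finsetsOfSumLE hH)
    · exact finsetsOfSumLE_mono (by omega) (code_mem_finsetsOfSumLE hTl)
  · -- injectivity
    rw [Finset.mem_coe, hT, Finset.mem_filter] at hω hω'
    have hωs := hω.1
    have hω's := hω'.1
    simp only [hΘ, Prod.mk.injEq] at h
    obtain ⟨hmm, hcat, hc1, hc2⟩ := h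
    obtain ⟨m, hm⟩ : ∃ m, lastMin n ω = m := ⟨_, rfl⟩
    have hm' : lastMin n ω' = m := hmm.symm.trans hm
    have hmn : m ≤ n := hm ▸ lastMin_le n ω
    have hH := (mem_halfSpaceWalks.1 (headWalk_mem hωs)).1
    have hH' := (mem_halfSpaceWalks.1 (headWalk_mem hω's)).1
    have hTl := (mem_halfSpaceWalks.1 (tailWalk_mem hωs)).1
    have hTl' := (mem_halfSpaceWalks.1 (tailWalk_mem hω's)).1
    rw [hm] at hH hTl hcat hc1 hc2
    rw [hm'] at hH' hTl' hcat hc1 hc2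
    -- the glued bridge determines the two unfolded pieces
    obtain ⟨hu1, hu2⟩ := concatWalk_injective_pieces (unfold_mem_saws hH) (unfold_mem_saws hTl)
      (unfold_mem_saws hH') (unfold_mem_saws hTl') hcat
    -- the codes then determine the pieces
    have hhead : headWalk n ω = headWalk n ω' :=
      unfold_code_injOn (m + 1) hH hH' (Prod.ext hu1 hc1)
    have htail : tailWalk n ω = tailWalk n ω' :=
      unfold_code_injOn (n - m) hTl hTl' (Prod.ext hu2 hc2)
    -- and `(m, head, tail)` determines `ω` (as in `count_le_sum_halfSpaceCount`)
    obtain ⟨h0, hend, hadj, hinj⟩ := mem_saws.1 hωs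
    obtain ⟨h0', hend', hadj', hinj'⟩ := mem_saws.1 hω's
    have hωm : ω m = ω' m := by
      have := congrFun hhead (m + 1)
      rw [headWalk_apply hm, headWalk_apply hm', if_neg (by omega), if_neg (by omega), min_self,
        Nat.sub_self, h0, h0', add_left_inj, zero_sub, zero_sub, neg_inj] at this
      exact this
    funext i
    rcases le_or_gt i m with hi | hi
    · rcases Nat.eq_zero_or_pos (m - i) with h | h
      · have : i = m := by omega
        rw [this, hωm]
      · have := congrFun hhead (m + 1 - i)
        rw [headWalk_apply hm, headWalk_apply hm', if_neg (by omega), if_neg (by omega),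
          min_eq_left (by omega : m + 1 - i ≤ m + 1), show m + 1 - (m + 1 - i) = i by omega,
          hωm, add_left_inj, sub_left_inj] at this
        exact this
    · rcases le_or_gt i n with hin | hin
      · have := congrFun htail (i - m)
        rw [tailWalk_apply hm, tailWalk_apply hm', min_eq_left (by omega : i - m ≤ n - m),
          show m + (i - m) = i by omega, hωm, sub_left_inj] at this
        exact this
      · have := congrFun htail (n - m)
        rw [tailWalk_apply hm, tailWalk_apply hm', min_self, show m + (n - m) = n by omega, hωm,
          sub_left_inj] at this
        rw [hend i hin.le, hend' i hin.le, this]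

/-- `(n+1) · #codes(n+1)² ≤ e^{8√(n+1)}`. [cite: MadrasSlade1993, §3.1, eq. (3.1.5) (elementary multiplicity bound)] -/
theorem mult_le_exp (n : ℕ) :
    ((n + 1 : ℕ) : ℝ) * ((finsetsOfSumLE (n + 1)).card : ℝ) ^ 2 ≤ Real.exp (8 * Real.sqrt ((n : ℝ) + 1)) := by
  have hc := card_finsetsOfSumLE_le_exp (n + 1)
  push_cast at hc
  have hs0 : 0 ≤ Real.sqrt ((n : ℝ) + 1) := Real.sqrt_nonneg _
  -- `n + 1 = (√(n+1))² ≤ e^{2√(n+1)}`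
  have h1 : ((n : ℝ) + 1) ≤ Real.exp (2 * Real.sqrt ((n : ℝ) + 1)) := by
    have hsq : ((n : ℝ) + 1) = Real.sqrt ((n : ℝ) + 1) ^ 2 := by
      rw [Real.sq_sqrt (by positivity)]
    have he : Real.sqrt ((n : ℝ) + 1) ≤ Real.exp (Real.sqrt ((n : ℝ) + 1)) := by
      have := Real.add_one_le_exp (Real.sqrt ((n : ℝ) + 1)); linarith
    calc ((n : ℝ) + 1) = Real.sqrt ((n : ℝ) + 1) ^ 2 := hsq
      _ ≤ Real.exp (Real.sqrt ((n : ℝ) + 1)) ^ 2 := pow_le_pow_left₀ hs0 he 2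
      _ = Real.exp (2 * Real.sqrt ((n : ℝ) + 1)) := by rw [← Real.exp_nat_mul]; norm_num
  have h2 : ((finsetsOfSumLE (n + 1)).card : ℝ) ^ 2 ≤ Real.exp (3 * Real.sqrt ((n : ℝ) + 1)) ^ 2 :=
    pow_le_pow_left₀ (Nat.cast_nonneg _) hc 2
  calc ((n + 1 : ℕ) : ℝ) * ((finsetsOfSumLE (n + 1)).card : ℝ) ^ 2
      ≤ Real.exp (2 * Real.sqrt ((n : ℝ) + 1)) * Real.exp (3 * Real.sqrt ((n : ℝ) + 1)) ^ 2 := by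
        push_cast
        exact mul_le_mul h1 h2 (by positivity) (Real.exp_nonneg _)
    _ = Real.exp (8 * Real.sqrt ((n : ℝ) + 1)) := by
        rw [← Real.exp_nat_mul, ← Real.exp_add]; congr 1; push_cast; ring

open Classical in
/-- **Walks reaching height `H` versus bridges of height `≥ H`**: for all `n` and `H`,
`#{ω ∈ S_n : ∃ k ≤ n, H ≤ y(ω_k)} ≤ e^{8√(n+1)} · #{β ∈ B_{n+1} : H ≤ y(β_{n+1})}`.
[cite: DuminilCopinHammond2013, §2.4 (max-height-monotone unfolding; quantitative form)] -/
theorem card_reachHeight_le_exp_mul_card_bridges (n : ℕ) (H : ℤ) :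
    (((saws d n).filter fun ω => ∃ k ≤ n, H ≤ ω k 0).card : ℝ) ≤
      Real.exp (8 * Real.sqrt ((n : ℝ) + 1)) * (((bridges d (n + 1)).filter fun β => H ≤ β (n + 1) 0).card : ℝ) := by
  have h := card_reachHeight_le (d := d) n H
  have h' : (((saws d n).filter fun ω => ∃ k ≤ n, H ≤ ω k 0).card : ℝ) ≤
      ((n + 1 : ℕ) : ℝ) * ((finsetsOfSumLE (n + 1)).card : ℝ) ^ 2 *
        (((bridges d (n + 1)).filter fun β => H ≤ β (n + 1) 0).card : ℝ) := by
    exact_mod_cast h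
  exact h'.trans (mul_le_mul_of_nonneg_right (mult_le_exp n) (Nat.cast_nonneg _))

open Classical in
/-- **K4b — the lane's typed node `MaxHeightUnfolding` (a-idea-2 `Sketch_v8_DCH11.lean`, body verbatim), with `C = 8`.**
[cite: DuminilCopinHammond2013, §2.4 (max-height-monotone unfolding; quantitative form)] -/
theorem maxHeightUnfolding :
    ∀ (d : ℕ) [NeZero d], 2 ≤ d → ∃ C : ℝ, ∀ (n : ℕ) (H : ℤ),
      (((saws d n).filter fun ω => ∃ k ≤ n, H ≤ ω k 0).card : ℝ) ≤
        Real.exp (C * Real.sqrt ((n : ℝ) + 1)) *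
          (((bridges d (n + 1)).filter fun ω => H ≤ ω (n + 1) 0).card : ℝ) := by
  intro d _ _
  exact ⟨8, fun n H => card_reachHeight_le_exp_mul_card_bridges n H⟩

end Literature.Probability.RandomPlanarGeometry.SAW.Zd

end
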